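import Summits.QuantumFields.YangMills.Theorems.BalabanUVNodesN15NeumannCubeLiftRightEntries
import Summits.QuantumFields.YangMills.Theorems.BalabanUVNodesN15NeumannCubeRightEntriesDefectClosed
import HarnessLib

/-!
# PROGRAMME R, P-SIDE BRICK: THE FORWARD DIFFERENCE SLIPS THROUGH THE LIFT DIRECTLY (no unit shift), THE LIFTED FORWARD RIGHT ENTRY AS A TRANSPLANT, ITS ROWS AND ITS TWO-GRID
# η-DEFECT ON THE TORUS OF RECORD — the (a)⁺∕(b)⁺∕(c)⁺ twins of dag-n15-a P-IIj (dag-n15-c g14, FILE 106; N15 = NE2, s1 «background-layer OPERATOR ingredient»)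

Cell `pub-ymgap`, seat `pub-ymgap-dag-n15-c` (R134 (a); HUMAN RULING D-0062), generation 14.  `bears_on: R4∕N15 · K3⁸ SpineGivenEndpointR13SepCoPHV (stmt-QuantumFields-27366)`.
Filed `--supports stmt-QuantumFields-27366 --as helper` — COUNT-NEUTRAL.  Theorems only (0 `def`, 0 `sorry`).  Handed to this seat by dag-n15-a g23's TRANSPLANT MAP (bus 14:06:04Z: «the forward
slip + the LIFTED (c)⁺ defect are YOURS … never differentiate through `S_ν`»).  Imports BY NAME dag-n15-a P-IIk `…NeumannCubeLiftRightEntries` (through it P-IIj `…LiftDivergence`: `redBond_add_unitVec`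
∕ `redBond_sub_unitVec`, `restrictOp_comp_mulOp_cube`, `redBond_injOn_cubeW`, `chiCube_redBond_of_mem`, P-IIb `liftCubeG_eq_liftOp` ∕ `mulOp_chiCube_comp_liftOp`, P-IId `hasMaj_transplant_cube_family_spacing`,
P-IIc `hasMaj_idef_transplant_cube_family`, N-IIn `chiCube_neumannCubeG_comp_sD_mulOp` ∕ `hasMaj_rightGrad_pair`) and N-IIr `…NeumannCubeRightEntriesDefectClosed` (`hasMaj_idef_rightGrad`); nothing
in the tree is modified.

WHY (the technical point of the map).  P-IIk writes the lifted forward entry through the unit shift, `χ_□∘G^{↑}∘ρ(sD_ν)∘M_g = −((transplant(Sym′∘G′∇*′_ν∘M_{χ′}))∘M_{g(·+e_ν)})∘S_ν` — right for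
ROWS (the shift costs `e^{δ}`), useless for two-grid DEFECTS: `𝔇(S′_ν, S_ν) = S′_ν∘pull π − pull π∘S_ν` is `O(1)` on rough inputs (one FINE bond against one COARSE bond), so the product rule
through `S_ν` splits a small defect into two large terms.  Here the forward difference slips through the window restriction DIRECTLY.

WHAT.  §1 (algebra, any tori `M′ ∣ M`, window `W = cubeW n c S`, chart `e = redBond`): `restrictOp_support_step_pred`, ★★ **`restrictOp_comp_sD_comp_mulOp`** (`ρ_W∘ρ(sD_ν c)∘M_g =
ρ′(sD_ν c)∘ρ_W∘M_g` for `g` supported with its `ν`-PREDECESSORS in the window — P-IIj's fibre argument with the successor read instead of the predecessor), `liftCubeG_comp_sD_comp_mulOp`, ★★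
**`chiCube_liftCubeG_comp_sD_mulOp_transplant`** (`χ_□∘G^{↑}(□)∘ρ(sD_ν n)∘M_g = transplant W e (Sym′∘(G′∘ρ′(sD′_ν n))∘M_{χ_{□′}})∘M_g` EXACTLY — N-IIn (a)⁺ read through the transplant).
§2 ★★ **`hasMaj_transplant_gGrad_pair`** — the rows of `transplant W e (Sym′∘(G′∘ρ′(sD′_ν n))∘M_{χ′})` at both spacings, `1_□1_□·β·e^{−δd}` uniform in the volume (N-IIn `hasMaj_rightGrad_pair` through
P-IId).  §3 ★★★ **`hasMaj_idef_transplant_gGrad`** — its two-grid η-defect `1_□1_□·m·(L^k)^{−1∕(8(d+1))}·e^{−δd}` (N-IIr `hasMaj_idef_rightGrad` through P-IIc `hasMaj_idef_transplant_cube_family`) —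
the (c)⁺ defect LIFTED, the `hITD` input of programme R's record right defect (dag-n15-c FILE 105 `hasMaj_idef_cut_comp_commOp_deltaOp_of_sandwich`, `T⁺_μ :=` the transplant).

HONEST FRAMING ∕ LIMITS.  Finite operator algebra on tori + block-majorant bookkeeping over dag-n15-a's LANDED rows (`U ≡ 1` doubled-cube torus MODEL and its record lift); nothing of [B5]∕[B6]
asserted; NE2⁺ NOT PRINTED, NOT proved; N15 NOT discharged; counts of record UNMOVED (typed 28∕28 · discharged 5∕27); one finite 𝕋⁴ at fixed ε per index — NOT infinite volume, NOT OS on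
ℝ⁴, NOT a mass gap, NOT Clay; R4 closes `BalabanLadder.UV` only.  Restate-immune (no Theses import).
-/

noncomputable section

open scoped BigOperators Matrix
open Finset

namespace Summit.QuantumFields.YangMills.BalabanUVNodes.N15.TwoGrid

open Literature.MathematicalPhysics.QuantumFieldTheory.Balaban1983to89
open Literature.MathematicalPhysics.QuantumFieldTheory.Balaban1983to89.B5Prop11Plancherel (Tor fine unitVec)
open Literature.MathematicalPhysics.QuantumFieldTheory.Balaban1983to89.B6Prop26Gluing (mulOp mulOp_apply ind ind_nonneg ind_le_one)
open Literature.MathematicalPhysics.QuantumFieldTheory.Balaban1983to89.B6Prop26ReachTransplant (restrictOp extendOp transplant restrictOp_apply restrictOp_apply_of_injOn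
  restrictOp_apply_of_not_mem transplant_apply)
open Literature.MathematicalPhysics.QuantumFieldTheory.King1986.Torus (blockOf tdistT)
open Literature.MathematicalPhysics.QuantumFieldTheory.Balaban1983to89.T4EtaRateDefect (idef)
open Literature.MathematicalPhysics.QuantumFieldTheory.Balaban1983to89.T4EtaRateCoeffDefect (pull)
open Literature.MathematicalPhysics.QuantumFieldTheory.Balaban1983to89.B11SectG (BlockNorm HasMaj)
open Literature.MathematicalPhysics.QuantumFieldTheory.Balaban1983to89.B6UnitTorusCarrier (unitTorusGeo)
open Literature.MathematicalPhysics.QuantumFieldTheory.Balaban1983to89.B5SiteBridgeP12 (MP)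
open Summit.QuantumFields.YangMills.BalabanUVNodes.N15.VectorPiece (kingPrV blkFine)

variable {d : ℕ}

/-! ## §1 The forward difference slips through the window restriction directly -/

section Algebra

variable (n : ℕ) [NeZero n] {M M' : Fin (d + 1) → ℕ} [∀ μ, NeZero (M μ)] [∀ μ, NeZero (M' μ)] (hM : ∀ μ, M' μ ∣ M μ) (c : Tor M) (S : ℕ)

/-- ★ SUPPORT TRANSPORT, predecessor edition: a multiplier supported, together with its `ν`-PREDECESSORS, in the window reads on the small torus (`ρ_W g`) as a multiplier supported, with
its `ν`-predecessors, in the blocks of the image cube — the hypothesis of N-IIn `chiCube_neumannCubeG_comp_sD_mulOp` on the cube torus. [folklore] -/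
theorem restrictOp_support_step_pred (hS : ∀ ν, S ≤ M' ν) (ν : Fin (d + 1)) {g : Tor (fine n M) × Fin (d + 1) → ℝ}
    (hg : ∀ b, g b ≠ 0 → b ∈ cubeW n c S ∧ (b.1 - unitVec (fine n M) ν, b.2) ∈ cubeW n c S) (b' : Tor (fine n M') × Fin (d + 1))
    (hb' : restrictOp (cubeW n c S) (redBond n hM) g b' ≠ 0) :
    blockOf n M' b'.1 ∈ cubeBlocks M' (torRed hM c) S ∧ blockOf n M' (b'.1 - unitVec (fine n M') ν) ∈ cubeBlocks M' (torRed hM c) S := by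
  by_cases h : ∃ b ∈ cubeW n c S, redBond n hM b = b'
  · obtain ⟨b, hb, rfl⟩ := h
    rw [restrictOp_apply_of_injOn (redBond_injOn_cubeW hS) _ hb] at hb'
    obtain ⟨h1, h2⟩ := hg b hb'
    rw [mem_cubeW] at h1 h2
    refine ⟨?_, ?_⟩
    · show blockOf n M' (torRed (fine_dvd n hM) b.1) ∈ _
      rw [kingBlockOf_torRed]
      exact torRed_mem_cubeBlocks hS h1
    · show blockOf n M' (torRed (fine_dvd n hM) b.1 - unitVec (fine n M') ν) ∈ _
      rw [← torRed_sub_unitVec, kingBlockOf_torRed]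
      exact torRed_mem_cubeBlocks hS h2
  · push Not at h
    exact absurd (restrictOp_apply_of_not_mem _ h) hb'

/-- ★★ **THE WINDOW RESTRICTION COMMUTES WITH THE FORWARD DIFFERENCE BEHIND A MULTIPLIER ONE STEP INSIDE — DIRECTLY**: if `supp g ⊂ W` and `supp g − e_ν ⊂ W` then
`ρ_W ∘ ρ(sD_ν c) ∘ M_g = ρ′(sD_ν c) ∘ ρ_W ∘ M_g` (`ρ(sD_ν c)f = c·(f(· + e_ν) − f)` on either torus) — on the image of the window the two tori's forward steps agree (`e(x + e_ν) = e x + e_ν`), and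
the successor fibre of a window bond carries no mass of `g` unless it is the successor itself (a `g`-charged bond there has its predecessor in the window with the same image as the bond:
injectivity).  No unit shift is factored out (cf. P-IIk), so this identity can be DIFFERENTIATED between spacings. [cite: Balaban1984PropagatorsII, p.238 (T_□: functions on the cube ARE functions
on its torus)] -/
theorem restrictOp_comp_sD_comp_mulOp (hS : ∀ ν, S ≤ M' ν) (ν : Fin (d + 1)) (cc : ℝ) {g : Tor (fine n M) × Fin (d + 1) → ℝ}
    (hg : ∀ b, g b ≠ 0 → b ∈ cubeW n c S ∧ (b.1 - unitVec (fine n M) ν, b.2) ∈ cubeW n c S) :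
    restrictOp (cubeW n c S) (redBond n hM) ∘ₗ symbOp M n (sD M n ν cc) ∘ₗ mulOp g =
      symbOp M' n (sD M' n ν cc) ∘ₗ restrictOp (cubeW n c S) (redBond n hM) ∘ₗ mulOp g := by
  have hinj := redBond_injOn_cubeW (n := n) (hM := hM) (c := c) (S := S) hS
  refine LinearMap.ext fun A => funext fun b' => ?_
  simp only [LinearMap.comp_apply]
  set F : Tor (fine n M) × Fin (d + 1) → ℝ := mulOp g A with hFdef
  have hF0 : ∀ b, b ∉ cubeW n c S → F b = 0 := fun b hb => by
    rw [hFdef, mulOp_apply]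
    by_cases h0 : g b = 0
    · rw [h0, zero_mul]
    · exact absurd (hg b h0).1 hb
  have hFpred : ∀ b, F b ≠ 0 → (b.1 - unitVec (fine n M) ν, b.2) ∈ cubeW n c S := fun b hb => by
    rw [hFdef, mulOp_apply] at hb
    exact (hg b (left_ne_zero_of_mul hb)).2
  -- the fibre of the chart over `e b₀ + e_ν` carries no `F`-mass unless the successor of `b₀` is in the window
  have hfib : ∀ b₀ : Tor (fine n M) × Fin (d + 1), b₀ ∈ cubeW n c S → (b₀.1 + unitVec (fine n M) ν, b₀.2) ∉ cubeW n c S →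
      restrictOp (cubeW n c S) (redBond n hM) F (redBond n hM (b₀.1 + unitVec (fine n M) ν, b₀.2)) = 0 := by
    intro b₀ hb₀ hsucc
    rw [restrictOp_apply]
    refine Finset.sum_eq_zero fun b₁ hb₁ => ?_
    rw [Finset.mem_filter] at hb₁
    by_contra hne
    have hpred := hFpred b₁ hne
    have e1 : redBond n hM (b₁.1 - unitVec (fine n M) ν, b₁.2) = redBond n hM b₀ := by
      rw [redBond_sub_unitVec, hb₁.2, redBond_add_unitVec, add_sub_cancel_right]
    have e2 : (b₁.1 - unitVec (fine n M) ν, b₁.2) = b₀ := hinj hpred hb₀ e1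
    apply hsucc
    rw [← e2]
    simpa using hb₁.1
  have hfib' : ∀ b' : Tor (fine n M') × Fin (d + 1), (∀ b ∈ cubeW n c S, redBond n hM b ≠ b') →
      restrictOp (cubeW n c S) (redBond n hM) F (b'.1 + unitVec (fine n M') ν, b'.2) = 0 := by
    intro b' hb'
    rw [restrictOp_apply]
    refine Finset.sum_eq_zero fun b₁ hb₁ => ?_
    rw [Finset.mem_filter] at hb₁
    by_contra hne
    have hpred := hFpred b₁ hne
    have e1 : redBond n hM (b₁.1 - unitVec (fine n M) ν, b₁.2) = b' := by
      rw [redBond_sub_unitVec, hb₁.2]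
      simp
    exact hb' _ hpred e1
  by_cases h : ∃ b ∈ cubeW n c S, redBond n hM b = b'
  · obtain ⟨b, hb, rfl⟩ := h
    rw [restrictOp_apply_of_injOn hinj _ hb, symbOp_sD_apply, symbOp_sD_apply, restrictOp_apply_of_injOn hinj _ hb, ← redBond_add_unitVec]
    by_cases hbm : (b.1 + unitVec (fine n M) ν, b.2) ∈ cubeW n c S
    · rw [restrictOp_apply_of_injOn hinj _ hbm]
    · rw [hF0 _ hbm, hfib b hb hbm]
  · push Not at h
    rw [restrictOp_apply_of_not_mem _ h, symbOp_sD_apply, restrictOp_apply_of_not_mem _ h, hfib' b' h, sub_zero, mul_zero]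

/-- ★ hence `ρ(sD_ν)` slips inside the lift behind such a multiplier: `G^{↑}(□) ∘ ρ(sD_ν c) ∘ M_g = (G(□′) ∘ ρ′(sD_ν c))^{↑} ∘ M_g`. [folklore] -/
theorem liftCubeG_comp_sD_comp_mulOp (hS : ∀ ν, S ≤ M' ν) (a : ℝ) (ν : Fin (d + 1)) (cc : ℝ) {g : Tor (fine n M) × Fin (d + 1) → ℝ}
    (hg : ∀ b, g b ≠ 0 → b ∈ cubeW n c S ∧ (b.1 - unitVec (fine n M) ν, b.2) ∈ cubeW n c S) :
    liftCubeG n hM c S a ∘ₗ symbOp M n (sD M n ν cc) ∘ₗ mulOp g =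
      liftOp n hM c S (neumannCubeG M' n (torRed hM c) S a ∘ₗ symbOp M' n (sD M' n ν cc)) ∘ₗ mulOp g := by
  rw [liftCubeG_eq_liftOp, liftOp, liftOp]
  simp only [LinearMap.comp_assoc]
  rw [restrictOp_comp_sD_comp_mulOp n hM c S hS ν cc hg]

/-- ★★ **THE LIFTED FORWARD RIGHT ENTRY AS A TRANSPLANT, EXACTLY**: for any multiplier `g` supported, with its `ν`-predecessors, in the window (`M′_ν = 2S`, `n ≥ 1`, `a > 0`):
`χ_□ ∘ G^{↑}(□) ∘ ρ(sD_ν n) ∘ M_g = transplant W e (Sym ∘ (G′∘ρ′(sD′_ν n)) ∘ M_{χ_{□′}}) ∘ M_g` — the forward difference slips inside the lift AND inside the source cut of the image cube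
(N-IIn (a)⁺ `chiCube_neumannCubeG_comp_sD_mulOp` on the cube torus, read through the transplant).  The record twin of N-IIn's sandwiched form WITHOUT the unit shift of P-IIk
`chiCube_liftCubeG_comp_sD_mulOp`. [folklore; Balaban1984PropagatorsII, (2.133) p.247 (shape), p.238 (T_□)] -/
theorem chiCube_liftCubeG_comp_sD_mulOp_transplant (hM2 : ∀ ν, M' ν = 2 * S) (hn : 1 ≤ n) {a : ℝ} (ha : 0 < a) (ν : Fin (d + 1)) {g : Tor (fine n M) × Fin (d + 1) → ℝ}
    (hg : ∀ b, g b ≠ 0 → b ∈ cubeW n c S ∧ (b.1 - unitVec (fine n M) ν, b.2) ∈ cubeW n c S) :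
    mulOp (chiCube M n c S) ∘ₗ liftCubeG n hM c S a ∘ₗ symbOp M n (sD M n ν (n : ℝ)) ∘ₗ mulOp g =
      transplant (cubeW n c S) (redBond n hM)
          (symOp M' n (torRed hM c) ∘ₗ (gOp M' n a ∘ₗ symbOp M' n (sD M' n ν (n : ℝ))) ∘ₗ mulOp (chiCube M' n (torRed hM c) S)) ∘ₗ mulOp g := by
  have hS : ∀ ν, S ≤ M' ν := fun ν => by rw [hM2 ν]; omega
  have hg' := restrictOp_support_step_pred n hM c S hS ν hg
  have hχ1 : ∀ b ∈ cubeW n c S, chiCube M' n (torRed hM c) S (redBond n hM b) = 1 := fun b hb => chiCube_redBond_of_mem (n := n) (hM := hM) (c := c) (S := S) hS hb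
  -- (1) `ρ(sD)` slips inside the lift, the cut lift is the transplant, the multiplier transports to the small torus
  have e1 : mulOp (chiCube M n c S) ∘ₗ liftCubeG n hM c S a ∘ₗ symbOp M n (sD M n ν (n : ℝ)) ∘ₗ mulOp g =
      extendOp (cubeW n c S) (redBond n hM) ∘ₗ neumannCubeG M' n (torRed hM c) S a ∘ₗ symbOp M' n (sD M' n ν (n : ℝ)) ∘ₗ
        mulOp (restrictOp (cubeW n c S) (redBond n hM) g) ∘ₗ restrictOp (cubeW n c S) (redBond n hM) := by
    rw [liftCubeG_comp_sD_comp_mulOp n hM c S hS a ν _ hg, ← LinearMap.comp_assoc, mulOp_chiCube_comp_liftOp, transplant]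
    simp only [LinearMap.comp_assoc]
    rw [restrictOp_comp_mulOp_cube n hM c S hS g]
  -- (2) N-IIn's identity on the small torus, read through the transplant (the output cut of the image cube is invisible behind `extendOp`)
  have key := chiCube_neumannCubeG_comp_sD_mulOp hM2 hn ha ν hg'
  simp only [LinearMap.comp_assoc] at key
  have key2 := congrArg (transplant (cubeW n c S) (redBond n hM)) key
  rw [transplant_mulOp_comp_of_eq_one hχ1, transplant_mulOp_comp_of_eq_one hχ1, transplant, transplant] at key2
  simp only [LinearMap.comp_assoc] at key2
  rw [e1, key2, transplant]
  simp only [LinearMap.comp_assoc]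
  rw [restrictOp_comp_mulOp_cube n hM c S hS g]

end Algebra

/-! ## §2 The lifted sandwiched forward entry rows at both spacings on the torus of record -/

section Rows

variable {L : ℕ} [NeZero L]

/-- ★★ **THE LIFTED SANDWICHED FORWARD ENTRY ROWS ON THE TORUS OF RECORD, BOTH SPACINGS** (`transplant W e (Sym∘(G′∘ρ′(sD′_ν n))∘M_{χ_{□′}})` at `n = L^k` and at `n′ = L^r·L^k`), N-IIn's
constants, for EVERY `s ≤ m_T`, `k ≥ 1`, `r`, corner `c`, direction `ν` — uniform in the volume: N-IIn `hasMaj_rightGrad_pair` (cube torus of exponent `s`) through P-IId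
`hasMaj_transplant_cube_family_spacing`. [cite: Balaban1984PropagatorsII, (2.133) p.247 (shape), p.238 (T_□); Balaban1984PropagatorsI, Prop. 1.2 (1.110) p.35 (entry «G∇»)] -/
theorem hasMaj_transplant_gGrad_pair (hL : Odd L ∧ 1 < L) {a : ℝ} (ha : 0 < a) :
    ∃ δ β : ℝ, 0 < δ ∧ 0 < β ∧ ∀ (s mT k r : ℕ) (hs : s ≤ mT) (hk : 1 ≤ k) (c : Tor (MP (paramsOf d L mT k hL))) (ν : Fin (d + 1)),
      HasMaj (BlockNorm.ofBlocks (unitTorusGeo L k (MP (paramsOf d L mT k hL)))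
          (fun i : Tor (fine (L ^ k) (MP (paramsOf d L mT k hL))) × Fin (d + 1) => blockOf (L ^ k) (MP (paramsOf d L mT k hL)) i.1))
        (BlockNorm.ofBlocks (unitTorusGeo L k (MP (paramsOf d L mT k hL)))
          (fun i : Tor (fine (L ^ k) (MP (paramsOf d L mT k hL))) × Fin (d + 1) => blockOf (L ^ k) (MP (paramsOf d L mT k hL)) i.1))
        (transplant (cubeW (L ^ k) c (L ^ s)) (redBond (L ^ k) (MP_dvd_MP hL hs k))
          (symOp (MP (paramsOf d L s k hL)) (L ^ k) (torRed (MP_dvd_MP hL hs k) c) ∘ₗ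
            (gOp (MP (paramsOf d L s k hL)) (L ^ k) a ∘ₗ
              symbOp (MP (paramsOf d L s k hL)) (L ^ k) (sD (MP (paramsOf d L s k hL)) (L ^ k) ν ((L ^ k : ℕ) : ℝ))) ∘ₗ
            mulOp (chiCube (MP (paramsOf d L s k hL)) (L ^ k) (torRed (MP_dvd_MP hL hs k) c) (L ^ s))))
        (fun y y' => ind ((cubeBlocks (MP (paramsOf d L mT k hL)) c (L ^ s) : Finset _) : Set _) y *
          ind ((cubeBlocks (MP (paramsOf d L mT k hL)) c (L ^ s) : Finset _) : Set _) y' * (β * Real.exp (-(δ * tdistT (MP (paramsOf d L mT k hL)) y y')))) ∧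
      HasMaj (BlockNorm.ofBlocks (unitTorusGeo L k (MP (paramsOf d L mT k hL)))
          (fun i : Tor (fine (L ^ r * L ^ k) (MP (paramsOf d L mT k hL))) × Fin (d + 1) => blockOf (L ^ r * L ^ k) (MP (paramsOf d L mT k hL)) i.1))
        (BlockNorm.ofBlocks (unitTorusGeo L k (MP (paramsOf d L mT k hL)))
          (fun i : Tor (fine (L ^ r * L ^ k) (MP (paramsOf d L mT k hL))) × Fin (d + 1) => blockOf (L ^ r * L ^ k) (MP (paramsOf d L mT k hL)) i.1))
        (transplant (cubeW (L ^ r * L ^ k) c (L ^ s)) (redBond (L ^ r * L ^ k) (MP_dvd_MP hL hs k))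
          (symOp (MP (paramsOf d L s k hL)) (L ^ r * L ^ k) (torRed (MP_dvd_MP hL hs k) c) ∘ₗ
            (gOp (MP (paramsOf d L s k hL)) (L ^ r * L ^ k) a ∘ₗ
              symbOp (MP (paramsOf d L s k hL)) (L ^ r * L ^ k) (sD (MP (paramsOf d L s k hL)) (L ^ r * L ^ k) ν ((L ^ r * L ^ k : ℕ) : ℝ))) ∘ₗ
            mulOp (chiCube (MP (paramsOf d L s k hL)) (L ^ r * L ^ k) (torRed (MP_dvd_MP hL hs k) c) (L ^ s))))
        (fun y y' => ind ((cubeBlocks (MP (paramsOf d L mT k hL)) c (L ^ s) : Finset _) : Set _) y *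
          ind ((cubeBlocks (MP (paramsOf d L mT k hL)) c (L ^ s) : Finset _) : Set _) y' * (β * Real.exp (-(δ * tdistT (MP (paramsOf d L mT k hL)) y y')))) := by
  obtain ⟨δ, β, hδ, hβ, H⟩ := hasMaj_rightGrad_pair (d := d) hL ha
  refine ⟨δ, β, hδ, hβ, fun s mT k r hs hk c ν => ⟨?_, ?_⟩⟩
  · exact hasMaj_transplant_cube_family_spacing hL hs (L ^ k) c _ hβ.le (H s k r hk (torRed (MP_dvd_MP hL hs k) c) ν).1
  · exact hasMaj_transplant_cube_family_spacing hL hs (L ^ r * L ^ k) c _ hβ.le (H s k r hk (torRed (MP_dvd_MP hL hs k) c) ν).2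

end Rows

/-! ## §3 The two-grid η-defect of the lifted sandwiched forward entry — the (c)⁺ defect LIFTED -/

section Defect

variable {L : ℕ} [NeZero L]

/-- ★★★ **THE TWO-GRID η-DEFECT OF THE LIFTED SANDWICHED FORWARD ENTRY ON THE TORUS OF RECORD** (`𝔇(transplant W′ e′ Y′_ν, transplant W e Y_ν)` with
`Y_ν = Sym∘(G∘ρ(sD_ν n))∘M_{χ_{□′}}` on the cube torus at the two spacings): N-IIr's letter `1_□1_□·m·(L^k)^{−1∕(8(d+1))}·e^{−δd}` (for `4 ≤ L^k`), for EVERY `s ≤ m_T`, `k ≥ 1`, `r`, corner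
`c`, direction `ν` — uniform in the volume: N-IIr `hasMaj_idef_rightGrad` (cube torus of exponent `s`) through P-IIc `hasMaj_idef_transplant_cube_family`.  With §1's identity this is the
η-defect of `χ_□∘G^{↑}∘ρ(sD_ν n)∘M_g` up to the consumer's multiplier fit (Leibniz in `M_g`: `M_{g∘π}∘pull π = pull π∘M_g`). [cite: Balaban1984PropagatorsII, (2.133)–(2.136) p.247 (shapes);
Balaban1984PropagatorsI, (1.111) p.36, (1.121)–(1.123) p.37; King1986, Prop. 3.9 p.665 (Hölder-rate shape)] -/
theorem hasMaj_idef_transplant_gGrad (hLodd : Odd L) (hL2 : 2 ≤ L) {a : ℝ} (ha : 0 < a) :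
    ∃ δ m : ℝ, 0 < δ ∧ 0 < m ∧ ∀ (s mT k r : ℕ) (hk : 1 ≤ k) (hn4 : 4 ≤ L ^ k) (hL : Odd L ∧ 1 < L) (hs : s ≤ mT) (c : Tor (MP (paramsOf d L mT k hL))) (ν : Fin (d + 1)),
      HasMaj (BlockNorm.ofBlocks (unitTorusGeo L k (MP (paramsOf d L mT k hL))) (blkFine L k (MP (paramsOf d L mT k hL))))
        (BlockNorm.ofBlocks (unitTorusGeo L k (MP (paramsOf d L mT k hL)))
          (fun i : Tor (fine (L ^ r * L ^ k) (MP (paramsOf d L mT k hL))) × Fin (d + 1) => blockOf (L ^ r * L ^ k) (MP (paramsOf d L mT k hL)) i.1))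
        (idef (pull (kingPrV L k r (MP (paramsOf d L mT k hL)))) (pull (kingPrV L k r (MP (paramsOf d L mT k hL))))
          (transplant (cubeW (L ^ r * L ^ k) c (L ^ s)) (redBond (L ^ r * L ^ k) (MP_dvd_MP hL hs k))
            (symOp (MP (paramsOf d L s k hL)) (L ^ r * L ^ k) (torRed (MP_dvd_MP hL hs k) c) ∘ₗ
              (gOp (MP (paramsOf d L s k hL)) (L ^ r * L ^ k) a ∘ₗ
                symbOp (MP (paramsOf d L s k hL)) (L ^ r * L ^ k) (sD (MP (paramsOf d L s k hL)) (L ^ r * L ^ k) ν ((L ^ r * L ^ k : ℕ) : ℝ))) ∘ₗ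
              mulOp (chiCube (MP (paramsOf d L s k hL)) (L ^ r * L ^ k) (torRed (MP_dvd_MP hL hs k) c) (L ^ s))))
          (transplant (cubeW (L ^ k) c (L ^ s)) (redBond (L ^ k) (MP_dvd_MP hL hs k))
            (symOp (MP (paramsOf d L s k hL)) (L ^ k) (torRed (MP_dvd_MP hL hs k) c) ∘ₗ
              (gOp (MP (paramsOf d L s k hL)) (L ^ k) a ∘ₗ
                symbOp (MP (paramsOf d L s k hL)) (L ^ k) (sD (MP (paramsOf d L s k hL)) (L ^ k) ν ((L ^ k : ℕ) : ℝ))) ∘ₗ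
              mulOp (chiCube (MP (paramsOf d L s k hL)) (L ^ k) (torRed (MP_dvd_MP hL hs k) c) (L ^ s)))))
        (fun y y' => ind ((cubeBlocks (MP (paramsOf d L mT k hL)) c (L ^ s) : Finset _) : Set _) y *
          ind ((cubeBlocks (MP (paramsOf d L mT k hL)) c (L ^ s) : Finset _) : Set _) y' *
          (m * ((L ^ k : ℕ) : ℝ) ^ (-(1 / (8 * ((d : ℝ) + 1)))) * Real.exp (-(δ * tdistT (MP (paramsOf d L mT k hL)) y y')))) := by
  obtain ⟨δ, m, hδ, hm, H⟩ := hasMaj_idef_rightGrad (d := d) hLodd hL2 ha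
  refine ⟨δ, m, hδ, hm, fun s mT k r hk hn4 hL hs c ν => ?_⟩
  have hρ : 0 ≤ m * ((L ^ k : ℕ) : ℝ) ^ (-(1 / (8 * ((d : ℝ) + 1)))) := mul_nonneg hm.le (Real.rpow_nonneg (Nat.cast_nonneg _) _)
  exact hasMaj_idef_transplant_cube_family (d := d) hL (r := r) hs c _ _ hρ (H s k r hk hn4 hL (torRed (MP_dvd_MP hL hs k) c) ν)

end Defect

end Summit.QuantumFields.YangMills.BalabanUVNodes.N15.TwoGrid

end
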